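import Mathlib
import Summits.Ventures.HodgeRepro2.T5GaloisHeckeBase

/-!
# The inert-place Hecke package for a quadratic extension: the star is any non-trivial automorphism

Blind cell `pub-hodge-repro2`, seat p8 (gen 13), Tier-5 kernel support.  `T5GaloisHeckeBase`
states the inert-place Hecke package for `U(2,1)` with the star an INVOLUTIVE `F`-automorphism
`τ` of `E` (the hypothesis `hτ : ∀ x, τ (τ x) = x`).  For a QUADRATIC extension `E / F` every
non-trivial `F`-automorphism is involutive (p4's `T5QuadraticAutomorphism.apply_apply`, packaged
as `T5StarOfInvolution.starRingOfQuadratic`), so the package holds with the star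
`starRingOfQuadratic h2 σ hσ` and NO involution hypothesis — exactly the record's setting
(`E_v / F_v` the unramified quadratic extension, the star its Galois conjugation):

* `heckeAlgebra_mul_comm_quadratic` — `H(U(2,1), K_U)` commutative;
* `finrank_invariants_eq_one_quadratic` — spherical multiplicity one;
* `apply_heckeSMul_doubleCosetOp_eq_inv_quadratic` — adjointness `B(T_g v, w) = B(v, T_{g⁻¹} w)`;
* `ncard_orbit_inv_eq_quadratic` — `#(K g⁻¹ K / K) = #(K g K / K)`;
* `exists_heckeAlgebra_mul_comm_quadratic` — the existential form for a Galois quadratic `E / F`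
  (some non-trivial `σ` exists: `T5StarOfInvolution.exists_ne_one_of_finrank_eq_two`).

Hypotheses: `R₀` a DVR with finite residue field and fraction field `F`; `E / F` of degree `2`
(separable); `𝒪_E = integralClosure R₀ E` local; `𝔭_{R₀} 𝒪_E = 𝔭_{𝒪_E}` (`e = 1`); `u ∈ R₀ˣ`.

README §8(d): uses an L-value-free non-vanishing device: NO.
-/

namespace Summit.Ventures.HodgeRepro2.T5QuadraticHeckePackage

open IsLocalRing T5StarOfInvolution T5GaloisHeckeBase

variable {R₀ F E : Type*} [CommRing R₀] [IsDomain R₀] [IsDiscreteValuationRing R₀] [Field F]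
  [Field E] [Algebra R₀ F] [IsFractionRing R₀ F] [Algebra F E] [Algebra R₀ E]
  [IsScalarTower R₀ F E] [FiniteDimensional F E] [Algebra.IsSeparable F E]
  [IsLocalRing (integralClosure R₀ E)] [Finite (ResidueField R₀)]
  (h2 : Module.finrank F E = 2) (σ : E ≃ₐ[F] E) (hσ : σ ≠ 1)

/-- **`H(U(2,1), K_U)` is commutative for a quadratic extension**, the star any non-trivial
`F`-automorphism `σ` (no involution hypothesis). -/
theorem heckeAlgebra_mul_comm_quadratic
    (hunr : (maximalIdeal R₀).map (algebraMap R₀ (integralClosure R₀ E)) =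
      maximalIdeal (integralClosure R₀ E)) (u : R₀ˣ) (k : Type*) [Field k] :
    letI := starRingOfQuadratic h2 σ hσ
    ∀ T S : T5HeckePermutationModule.heckeAlgebra k (T5UnitaryHeckeAdjoint.hyperspecialSubgroup
      (integralClosure R₀ E) (T5HermitianThreeElements.J3 (algebraMap R₀ E (u : R₀)))),
      T * S = S * T :=
  heckeAlgebra_mul_comm_galois_base σ (T5QuadraticAutomorphism.apply_apply h2 σ hσ) hunr u k

/-- **Spherical multiplicity one for a quadratic extension.** -/
theorem finrank_invariants_eq_one_quadratic
    (hunr : (maximalIdeal R₀).map (algebraMap R₀ (integralClosure R₀ E)) =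
      maximalIdeal (integralClosure R₀ E)) (u : R₀ˣ) {k : Type*} [Field k] [CharZero k]
    [IsAlgClosed k] {V : Type*} [AddCommGroup V] [Module k V] :
    letI := starRingOfQuadratic h2 σ hσ
    ∀ (ρ : Representation k (T5UnitaryGroupForm.formUnitaryGroup
      (T5HermitianThreeElements.J3 (algebraMap R₀ E (u : R₀)))) V) [ρ.IsIrreducible],
      T5LevelIdempotent.KFinite ρ (T5UnitaryHeckeAdjoint.hyperspecialSubgroup (integralClosure R₀ E)
        (T5HermitianThreeElements.J3 (algebraMap R₀ E (u : R₀)))) →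
      ∀ [FiniteDimensional k (LevelPositivity.invariants ρ (T5UnitaryHeckeAdjoint.hyperspecialSubgroup
        (integralClosure R₀ E) (T5HermitianThreeElements.J3 (algebraMap R₀ E (u : R₀)))))],
      LevelPositivity.invariants ρ (T5UnitaryHeckeAdjoint.hyperspecialSubgroup (integralClosure R₀ E)
        (T5HermitianThreeElements.J3 (algebraMap R₀ E (u : R₀)))) ≠ ⊥ →
      Module.finrank k (LevelPositivity.invariants ρ (T5UnitaryHeckeAdjoint.hyperspecialSubgroup
        (integralClosure R₀ E) (T5HermitianThreeElements.J3 (algebraMap R₀ E (u : R₀))))) = 1 :=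
  finrank_invariants_eq_one_galois_base σ (T5QuadraticAutomorphism.apply_apply h2 σ hσ) hunr u

/-- **Adjointness `B(T_g v, w) = B(v, T_{g⁻¹} w)` for a quadratic extension.** -/
theorem apply_heckeSMul_doubleCosetOp_eq_inv_quadratic
    (hunr : (maximalIdeal R₀).map (algebraMap R₀ (integralClosure R₀ E)) =
      maximalIdeal (integralClosure R₀ E)) (u : R₀ˣ) {k : Type*} [Field k] [StarRing k]
    {V : Type*} [AddCommGroup V] [Module k V] :
    letI := starRingOfQuadratic h2 σ hσ
    haveI : IsFractionRing (integralClosure R₀ E) E :=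
      integralClosure.isFractionRing_of_finite_extension F E
    haveI : IsDiscreteValuationRing (integralClosure R₀ E) :=
      T5UnramifiedUniformiser.isDiscreteValuationRing_integralClosure R₀ F E
    haveI : Finite (ResidueField (integralClosure R₀ E)) :=
      T5ResidueFieldFinite.finite_residueField_integralClosure R₀ F E
    ∀ {ρ : Representation k (T5UnitaryGroupForm.formUnitaryGroup
        (T5HermitianThreeElements.J3 (algebraMap R₀ E (u : R₀)))) V}
      {B : V →ₗ⋆[k] V →ₗ[k] k}, T5HeckeAdjointHermitian.IsInvariantSesq ρ B →
      T5HeckeAdjointHermitian.IsHermitian B →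
      ∀ (g : T5UnitaryGroupForm.formUnitaryGroup
          (T5HermitianThreeElements.J3 (algebraMap R₀ E (u : R₀))))
        (v w : LevelPositivity.invariants ρ (T5UnitaryHeckeAdjoint.hyperspecialSubgroup
          (integralClosure R₀ E) (T5HermitianThreeElements.J3 (algebraMap R₀ E (u : R₀))))),
        B (T5HeckePermutationModule.heckeSMul ρ (T5HeckeDoubleCoset.doubleCosetOp k
          (T5UnitaryHeckeAdjoint.hyperspecialSubgroup (integralClosure R₀ E)
            (T5HermitianThreeElements.J3 (algebraMap R₀ E (u : R₀)))) g) v) w =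
        B v (T5HeckePermutationModule.heckeSMul ρ (T5HeckeDoubleCoset.doubleCosetOp k
          (T5UnitaryHeckeAdjoint.hyperspecialSubgroup (integralClosure R₀ E)
            (T5HermitianThreeElements.J3 (algebraMap R₀ E (u : R₀)))) g⁻¹) w) :=
  apply_heckeSMul_doubleCosetOp_eq_inv_galois_base σ
    (T5QuadraticAutomorphism.apply_apply h2 σ hσ) hunr u

omit [Finite (ResidueField R₀)] in
/-- `#(K g⁻¹ K / K) = #(K g K / K)` for a quadratic extension. -/
theorem ncard_orbit_inv_eq_quadratic
    (hunr : (maximalIdeal R₀).map (algebraMap R₀ (integralClosure R₀ E)) =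
      maximalIdeal (integralClosure R₀ E)) (u : R₀ˣ) :
    letI := starRingOfQuadratic h2 σ hσ
    ∀ g : T5UnitaryGroupForm.formUnitaryGroup
      (T5HermitianThreeElements.J3 (algebraMap R₀ E (u : R₀))),
      (MulAction.orbit (T5UnitaryHeckeAdjoint.hyperspecialSubgroup (integralClosure R₀ E)
        (T5HermitianThreeElements.J3 (algebraMap R₀ E (u : R₀))))
        (QuotientGroup.mk g⁻¹ : _ ⧸ T5UnitaryHeckeAdjoint.hyperspecialSubgroup (integralClosure R₀ E)
          (T5HermitianThreeElements.J3 (algebraMap R₀ E (u : R₀))))).ncard =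
      (MulAction.orbit (T5UnitaryHeckeAdjoint.hyperspecialSubgroup (integralClosure R₀ E)
        (T5HermitianThreeElements.J3 (algebraMap R₀ E (u : R₀))))
        (QuotientGroup.mk g : _ ⧸ T5UnitaryHeckeAdjoint.hyperspecialSubgroup (integralClosure R₀ E)
          (T5HermitianThreeElements.J3 (algebraMap R₀ E (u : R₀))))).ncard :=
  ncard_orbit_inv_eq_galois_base σ (T5QuadraticAutomorphism.apply_apply h2 σ hσ) hunr u

omit σ hσ in
/-- For a GALOIS quadratic extension a non-trivial automorphism exists, and the Hecke algebra is
commutative for the star it defines. -/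
theorem exists_heckeAlgebra_mul_comm_quadratic [IsGalois F E]
    (hunr : (maximalIdeal R₀).map (algebraMap R₀ (integralClosure R₀ E)) =
      maximalIdeal (integralClosure R₀ E)) (u : R₀ˣ) (k : Type*) [Field k] :
    ∃ (σ : E ≃ₐ[F] E) (hσ : σ ≠ 1),
      letI := starRingOfQuadratic h2 σ hσ
      ∀ T S : T5HeckePermutationModule.heckeAlgebra k (T5UnitaryHeckeAdjoint.hyperspecialSubgroup
        (integralClosure R₀ E) (T5HermitianThreeElements.J3 (algebraMap R₀ E (u : R₀)))),
        T * S = S * T := by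
  obtain ⟨σ, hσ⟩ := exists_ne_one_of_finrank_eq_two (F := F) (E := E) h2
  exact ⟨σ, hσ, heckeAlgebra_mul_comm_quadratic h2 σ hσ hunr u k⟩

end Summit.Ventures.HodgeRepro2.T5QuadraticHeckePackage
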